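import Mathlib
import HarnessLib
import Summits.ValiantsHypothesis.ValiantsHypothesis.Theses.MonotoneRestoration
import Literature.Computability.AlgebraicComplexity.ArithCircuit
import Literature.Computability.AlgebraicComplexity.ArithCircuitProofs
import Literature.Computability.AlgebraicComplexity.MonotoneStructure
import Literature.Computability.AlgebraicComplexity.PermanentIrreducible
import Literature.ModelTheory.FiniteModelTheory.CkEquiv
import Summits.ValiantsHypothesis.ValiantsHypothesis.Theorems.MonotoneRestorationMonotoneRestorationQPCosetCount
import Summits.ValiantsHypothesis.ValiantsHypothesis.Theorems.MonotoneRestorationMonotoneRestorationQPSymmetricLB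
import Summits.ValiantsHypothesis.ValiantsHypothesis.Theorems.MonotoneRestorationMonotoneRestorationQPSupportSymmetrisation
import Summits.ValiantsHypothesis.ValiantsHypothesis.Theorems.MonotoneRestorationMonotoneRestorationQPSparseRegime
import Summits.ValiantsHypothesis.ValiantsHypothesis.Theorems.MonotoneRestorationMonotoneRestorationQPBeta
import Literature.Computability.AlgebraicComplexity.SymmetricArithCircuit
import Literature.Computability.AlgebraicComplexity.DawarWilsenach2025Proofs
import Literature.GroupTheory.PermutationGroups.SmallIndexSubgroups
import Summits.ValiantsHypothesis.ValiantsHypothesis.Theorems.MonotoneRestorationQP.Negative.LoadBearing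
import Summits.ValiantsHypothesis.ValiantsHypothesis.Theorems.MonotoneRestorationMonotoneRestorationQPPermSupportCount
import Summits.ValiantsHypothesis.ValiantsHypothesis.Theorems.MonotoneRestorationMonotoneRestorationQPMonotoneComputationOfComplexity

/-! TTRL-lite variant V19022 of stmt-ValiantsHypothesis-15886 -/

set_option linter.dupNamespace false

namespace Summit.ValiantsHypothesis.ValiantsHypothesis.Theorems

open Summit.ValiantsHypothesis.ValiantsHypothesis.Theses.MonotoneRestoration
open Literature.Computability.AlgebraicComplexity

/-- TTRL-lite variant V19022 (`small_case`: the one-gate kernel `complexity f ≤ 1`) of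
`stub_monotoneComputation_of_complexity` (`stmt-ValiantsHypothesis-15886`): a polynomial
`f : MvPolynomial σ ℝ≥0` of weighted fan-in-two complexity at most `1` has a Jerrum–Snir monotone
computation (fan-in two, all sum coefficients `1`) with at most `3` gates. Immediate from the
tree's `stub_monotoneComputation_of_complexity` (size `≤ 3 · complexity f`) and
`3 · complexity f ≤ 3`. [cite: JerrumSnir1982, §2.2] -/
theorem stub_monotoneComputation_of_complexity_var19022 :
    ∀ (σ : Type) (f : MvPolynomial σ NNReal), complexity f ≤ 1 →
      ∃ P : ArithCircuit NNReal σ,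
        Literature.Barriers.ValiantsHypothesis.IsMonotoneComputation P f ∧ P.size ≤ 3 := by
  intro σ f hf
  obtain ⟨P, hP, hsize⟩ := stub_monotoneComputation_of_complexity f
  exact ⟨P, hP, by omega⟩

end Summit.ValiantsHypothesis.ValiantsHypothesis.Theorems
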